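import Mathlib
import HarnessLib
import Summits.HubbardSuperconductivity.HubbardSuperconductivity.Theorems.KLProgrammeSWaveCascadeArrayVariation
import Summits.HubbardSuperconductivity.HubbardSuperconductivity.Theorems.KLProgrammeKLRegimeSplitFlowPairArrayEdgeAllScales

/-!
# Route `KLProgramme` — crux K3 gen 8, CHILD 1 (stmt-HubbardSuperconductivity-20438) in scheme F-II: the TOTAL VARIATION ACROSS ALL SCALES of the pair amplitudes
# on the Cooper ball is `U`-CURRENCY at EVERY total momentum, the pinned transfer included — `flowPairArray_variation_edge`, `pairArrayVariation_of_edgeClauses_explicit`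

Cell gate-hubbard-kl, seat hubbard-kl-k3c1-p1 (g19; child-1 lineage; technique «composed-map remainder propagation»).  Sequel to `…KLRegimeSplitFlowPairArrayEdgeAllScales`
(p701622) over the carrier-generic `SWaveCascade.amplitudeArray_variation_edge` (`…SWaveCascadeArrayVariation`); pen g25 (R366)(q-α2)/(R367)/(R368)(A)/(R372)(B).
Located fact of record (p1b g17, (R367)): the engine's value-INCREMENT slots (`PairValueIncrementAtV17F`) have majorants `∝ (Klam U)²×gains` that SATURATE at the
Cooper transfer, so their scale sum is `(Klam U)²·n` AT the pinned transfer — not `U`-currency; and child 1's envelope `PairArrayAtV17F` carries no cross-scale link.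
Here, under the SAME edge-clause hypotheses from which child 1 proves `PairArrayAtV17F` (`pairArrayAtV17F_of_edgeClauses_explicit`, `…BetaSplitEdgeF`), the pair
amplitudes `𝒞_j[K_j](Qm;k,k′)` on `klBall L μ 0` satisfy, for EVERY `Qm` (in-class at all scales or not) and every `k, k′` in the ball,

  `Σ_{j<n} ‖𝒞_{j+1}[K_{j+1}](Qm;k,k′) − 𝒞_j[K_j](Qm;k,k′)‖ ≤ (11/9)·U + (C_W + klLegKappa·CR·Klam³)·U²`

(**`pairArrayVariation_of_edgeClauses_explicit`**, last clause) — uniformly in `n`: the Cooper-ball values have `U`-currency total variation down to the last scale.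
Mechanism: every in-class step moves EVERY ball entry by the same scalar Riccati decrement `u_{j+1} − u_j = −W_j u_j u_{j+1}` up to a mass-weighted remainder
(the INCREMENT LAW, also exported: `‖𝒞_{j+1} − 𝒞_j − (u_{j+1} − u_j)‖ ≤ m_j·(C_W′U²)·((7/3)U + (13/12)C_W′U²) + (drivePBar_j + ē_j) + X_{j+1}`, `C_W′ = C_W + κ·CR·Klam³`);
the decrements are those of a quasi-monotone sequence in `[0, (16/15)U]` (total `≤ (257/225)·U`), the remainders are absorbed by the no-onset line, and past
the class exit the frozen increments sum to `O(U²)`.  **`flowPairArray_variation_edge`** is the same one level down (hypotheses of `flowPairArray_envelope_edge`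
verbatim, generic budgets).  No registered text and no landed file is touched.  Nothing here asserts that the model's amplitudes satisfy the hypotheses (the
engine's (E2-F2)/(E2″-F) output); nothing converts values into the sectorised `L¹` norm ((q-α1)); nothing asserts superconductivity.  Everything is proved; no definitions.
-/

noncomputable section

namespace Summit.HubbardSuperconductivity.HubbardSuperconductivity.Theorems.KLRegimeSplit

set_option linter.dupNamespace false -- summit = problem name (single-conjunct summit), D-0017

open Real Finset Literature.MathematicalPhysics.QuantumLattice Literature.Probability.LatticeModels
open Summit.HubbardSuperconductivity.HubbardSuperconductivity.Theorems.KLProgrammeLegKernels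
open Summit.HubbardSuperconductivity.HubbardSuperconductivity.Theorems.CooperChannelRiccatiFlow
open Summit.HubbardSuperconductivity.HubbardSuperconductivity.Theorems.SWaveCascade

section Model

variable (L M : ℕ) [NeZero L] [NeZero M]

variable {G : GeoConsts} {P : SplitConsts} {Qc : EngConsts}

/-- **Row 0′ on the cross-frame carrier of scheme F-II — ALL-SCALES EXPORT, INCREMENT LAW, `U`-CURRENCY TOTAL VARIATION** (hypotheses of
`flowPairArray_envelope_edge` verbatim; conclusion = `SWaveCascade.amplitudeArray_variation_edge`'s for `klPairAmplitude … (klFlowFrameU … j) j Qm` on `klBall L μ 0`). -/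
theorem flowPairArray_variation_edge (hG : G.WF) (hP : P.WF) (hQc : Qc.WF) {β U μ : ℝ} (hU : 0 ≤ U)
    {n : ℕ} (X : ℕ → TorusSite 2 L → TorusSite 2 L → TorusSite 2 L → ℝ) {Xtot Xsup : ℝ}
    (hX0 : ∀ j Qm k k', 0 ≤ X j Qm k k') (hXtot0 : 0 ≤ Xtot) (hXsup0 : 0 ≤ Xsup)
    (hXsup : ∀ j Qm k k', X j Qm k k' ≤ Xsup)
    (hXsum : ∀ (t : ℕ) (Qm k k' : TorusSite 2 L), ∑ j ∈ Ioc t n, X j Qm k k' ≤ Xtot)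
    (hXtot : ∀ Qm k k' : TorusSite 2 L, X 0 Qm k k' + ∑ i ∈ range n, X (i + 1) Qm k k' ≤ Xtot)
    (δ : ℕ → TorusSite 2 L → ℝ)
    (hneg : ∀ Qm : TorusSite 2 L, ∀ t ≤ n, IsPairClassAt L Qm t → 16 * U * ∑ i ∈ range t, δ (i + 1) Qm ≤ 1)
    (h0 : ∀ Qm : TorusSite 2 L, ∀ k ∈ klBall L μ 0, ∀ k' ∈ klBall L μ 0,
      ‖klPairAmplitude L M β U μ (klFlowFrameU L M β U μ 0) 0 Qm k k' - (U : ℂ)‖ ≤ initDevBar G U + X 0 Qm k k')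
    (hsteps : ∀ j, 1 ≤ j → j ≤ n → ∀ Qm : TorusSite 2 L, IsPairClassAt L Qm j →
      ∃ w : TorusSite 2 L → ℝ, (∑ p, |w p| ≤ G.bhi) ∧ (∑ p, (|w p| - w p) ≤ δ j Qm) ∧
        ∃ N : Matrix (TorusSite 2 L) (TorusSite 2 L) ℂ,
          (1 + Matrix.diagonal (fun p => (w p : ℂ)) * klPairArrayF L M β U μ (j - 1) Qm) * N = 1 ∧
          ∀ k ∈ klBall L μ 0, ∀ k' ∈ klBall L μ 0,
            ‖klPairAmplitude L M β U μ (klFlowFrameU L M β U μ j) j Qm k k' - (klPairArrayF L M β U μ (j - 1) Qm * N) k k'‖ ≤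
              drivePBar G P U (j - 1) + eremBar G P Qc U β L (j - 1) + X j Qm k k')
    (hincr : ∀ j, 1 ≤ j → j ≤ n → ∀ Qm : TorusSite 2 L, ∀ k ∈ klBall L μ 0, ∀ k' ∈ klBall L μ 0,
      ‖klPairAmplitude L M β U μ (klFlowFrameU L M β U μ j) j Qm k k' -
          klPairAmplitude L M β U μ (klFlowFrameU L M β U μ (j - 1)) (j - 1) Qm k k'‖ ≤
        gainBar G P U j (klTorusNorm L Qm) (klTorusNorm L (k - k')) (klTorusNorm L (k + k' - Qm)) +
          eremBar G P Qc U β L (j - 1) + X j Qm k k')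
    (Qm : TorusSite 2 L)
    (hsmall : 8 * 42 * ((initDevBar G U + ∑ j ∈ range n, (drivePBar G P U j + eremBar G P Qc U β L j) + Xtot) +
        (∑ j ∈ range n, (drivePBar G P U j + eremBar G P Qc U β L j) + Xsup)) * (G.bhi * n) ≤ 1) :
    ∃ Us W m : ℕ → ℝ, Us 0 = U ∧ (∀ i, Us (i + 1) = Us i / (1 + W i * Us i)) ∧
      (∀ i, |W i| ≤ m i ∧ m i ≤ G.bhi) ∧
      (∀ i < n, IsPairClassAt L Qm (i + 1) → m i - W i ≤ δ (i + 1) Qm) ∧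
      (∀ i, (n ≤ i ∨ ¬ IsPairClassAt L Qm (i + 1)) → W i = 0 ∧ m i = 0) ∧
      16 * U * ∑ i ∈ range n, (m i - W i) ≤ 1 ∧
      (∀ j ≤ n, 0 ≤ Us j ∧ Us j ≤ 16 / 15 * U ∧ ∀ k ∈ klBall L μ 0, ∀ k' ∈ klBall L μ 0,
        ‖klPairAmplitude L M β U μ (klFlowFrameU L M β U μ j) j Qm k k' - (Us j : ℂ)‖ ≤
          12 * ((initDevBar G U + ∑ j ∈ range n, (drivePBar G P U j + eremBar G P Qc U β L j) + Xtot) +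
            (∑ j ∈ range n, (drivePBar G P U j + eremBar G P Qc U β L j) + Xsup)) +
          ((P.Klam * U) ^ 2 * (3 * G.CF) + Xtot + ∑ i ∈ range n, eremBar G P Qc U β L i)) ∧
      (∀ i < n, IsPairClassAt L Qm (i + 1) → ∀ k ∈ klBall L μ 0, ∀ k' ∈ klBall L μ 0,
        ‖klPairAmplitude L M β U μ (klFlowFrameU L M β U μ (i + 1)) (i + 1) Qm k k' -
            klPairAmplitude L M β U μ (klFlowFrameU L M β U μ i) i Qm k k' - ((Us (i + 1) - Us i : ℝ) : ℂ)‖ ≤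
          m i * ((2 * (16 / 15 * U) + 12 * ((initDevBar G U + ∑ j ∈ range n, (drivePBar G P U j + eremBar G P Qc U β L j) + Xtot) +
            (∑ j ∈ range n, (drivePBar G P U j + eremBar G P Qc U β L j) + Xsup)) +
              (∑ j ∈ range n, (drivePBar G P U j + eremBar G P Qc U β L j) + Xsup)) * (12 * ((initDevBar G U + ∑ j ∈ range n, (drivePBar G P U j + eremBar G P Qc U β L j) + Xtot) +
            (∑ j ∈ range n, (drivePBar G P U j + eremBar G P Qc U β L j) + Xsup))) +
            (∑ j ∈ range n, (drivePBar G P U j + eremBar G P Qc U β L j) + Xsup) * (16 / 15 * U)) +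
          (drivePBar G P U i + eremBar G P Qc U β L i) + X (i + 1) Qm k k') ∧
      ∀ k ∈ klBall L μ 0, ∀ k' ∈ klBall L μ 0,
        ∑ i ∈ range n, ‖klPairAmplitude L M β U μ (klFlowFrameU L M β U μ (i + 1)) (i + 1) Qm k k' -
            klPairAmplitude L M β U μ (klFlowFrameU L M β U μ i) i Qm k k'‖ ≤
          11 / 9 * U + 3 / 2 * ((initDevBar G U + ∑ j ∈ range n, (drivePBar G P U j + eremBar G P Qc U β L j) + Xtot) +
            (∑ j ∈ range n, (drivePBar G P U j + eremBar G P Qc U β L j) + Xsup)) +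
          ((P.Klam * U) ^ 2 * (3 * G.CF) + Xtot + ∑ i ∈ range n, eremBar G P Qc U β L i) := by
  classical
  have hG' := hG
  obtain ⟨-, -, -, -, -, -, -, -, -, -, -, hpp0, hph0, hCF, hphsum, hppsum, -⟩ := hG'
  have hbhi : 0 ≤ G.bhi := hG.2.2.1.trans hG.2.2.2.1
  have hinit0 : 0 ≤ initDevBar G U := by
    unfold initDevBar
    refine mul_nonneg (add_nonneg (sum_nonneg fun χ _ => add_nonneg (hG.2.1 χ) (hG.1 χ)) zero_le_one) (sq_nonneg U)
  have hGtot0 : 0 ≤ (P.Klam * U) ^ 2 * (3 * G.CF) := by positivity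
  -- the gain majorant is nonnegative
  have hgain0 : ∀ (j : ℕ) (k k' : TorusSite 2 L),
      0 ≤ gainBar G P U j (klTorusNorm L Qm) (klTorusNorm L (k - k')) (klTorusNorm L (k + k' - Qm)) := by
    intro j k k'
    unfold gainBar
    exact mul_nonneg (sq_nonneg _) (add_nonneg (add_nonneg (hpp0 _ _) (hph0 _ _)) (hph0 _ _))
  -- the frozen-gain line past the class exit, from `G.WF`'s gain sums
  have hg : ∀ t ≤ n, ¬ IsPairClassAt L Qm (t + 1) → ∀ k ∈ klBall L μ 0, ∀ k' ∈ klBall L μ 0,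
      ∑ j ∈ Ioc t n, gainBar G P U j (klTorusNorm L Qm) (klTorusNorm L (k - k')) (klTorusNorm L (k + k' - Qm)) ≤
        (P.Klam * U) ^ 2 * (3 * G.CF) := by
    intro t _ hexit k _ k' _
    have hexit' : ((4 : ℝ) ^ (t + 1))⁻¹ < klTorusNorm L Qm := lt_of_not_ge hexit
    have h1 : ∑ j ∈ Ioc t n, G.ppGain j (klTorusNorm L Qm) ≤ G.CF := hppsum _ t n hexit'
    have hsub : ∀ ρ : ℝ, ∑ j ∈ Ioc t n, G.phGain j ρ ≤ ∑ j ∈ range (n + 1), G.phGain j ρ := fun ρ =>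
      sum_le_sum_of_subset_of_nonneg (fun j hj => by simp only [mem_Ioc] at hj; exact mem_range.2 (by omega)) fun j _ _ => hph0 j ρ
    have h2 : ∑ j ∈ Ioc t n, G.phGain j (klTorusNorm L (k - k')) ≤ G.CF :=
      (hsub _).trans (hphsum _ (n + 1) (torusSupNorm_nonneg _))
    have h3 : ∑ j ∈ Ioc t n, G.phGain j (klTorusNorm L (k + k' - Qm)) ≤ G.CF :=
      (hsub _).trans (hphsum _ (n + 1) (torusSupNorm_nonneg _))
    simp only [gainBar, ← mul_sum, sum_add_distrib]
    nlinarith [h1, h2, h3, sq_nonneg (P.Klam * U)]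
  exact amplitudeArray_variation_edge (klBall L μ 0) (fun j => klPairAmplitude L M β U μ (klFlowFrameU L M β U μ j) j Qm)
    (IsPairClassAt L Qm) (fun h hjm => isPairClassAt_mono L h hjm) hU hbhi hinit0 hGtot0
    (fun j => drivePBar G P U j + eremBar G P Qc U β L j) (fun j => eremBar G P Qc U β L j)
    (fun j => add_nonneg (drivePBar_nonneg' hG U j) (eremBar_nonneg' hG hP hQc U β L j))
    (fun j => eremBar_nonneg' hG hP hQc U β L j)
    (fun j k k' => gainBar G P U j (klTorusNorm L Qm) (klTorusNorm L (k - k')) (klTorusNorm L (k + k' - Qm)))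
    (fun j => X j Qm) hgain0 (fun j k k' => hX0 j Qm k k') hXtot0 hXsup0 (fun j k k' => hXsup j Qm k k') (fun t k k' => hXsum t Qm k k')
    (fun k k' => hXtot Qm k k') (fun j => δ j Qm) (hneg Qm) (h0 Qm)
    (fun j hj1 hjn hQj => hsteps j hj1 hjn Qm hQj) (fun j hj1 hjn k hk k' hk' => hincr j hj1 hjn Qm k hk k' hk') hg hsmall

set_option maxHeartbeats 400000 in -- polynomial bookkeeping (`nlinarith`/`linarith` on ~10 atoms), as in `pairArrayAtV17F_of_edgeClauses_explicit`
/-- **Row 0′ with the constants chosen — the `U`-CURRENCY TOTAL VARIATION of the Cooper-ball pair amplitudes across ALL scales** (hypotheses of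
`pairArrayAtV17F_of_edgeClauses_explicit` VERBATIM).  Per total momentum `Qm`: the comparison sequence `u` with all clauses of `pairArrayAllScales_of_edgeClauses_explicit`
(exact law, signed masses, negative-mass line, quasi-monotonicity, total variation `≤ (257/225)·U` of `u`, the (B1-F) envelope at every `j ≤ n`) PLUS the in-class INCREMENT
LAW `‖𝒞_{i+1}[K_{i+1}] − 𝒞_i[K_i] − (u (i+1) − u i)‖ ≤ m i·(C_W′U²)·((7/3)·U + (13/12)·C_W′U²) + (drivePBar i + ē i) + X (i+1) Qm k k′` (`C_W′ = C_W + klLegKappa·CR·Klam³`) PLUS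
`Σ_{i<n} ‖𝒞_{i+1}[K_{i+1}](Qm;k,k′) − 𝒞_i[K_i](Qm;k,k′)‖ ≤ (11/9)·U + C_W′·U²` on `klBall L μ 0`. -/
theorem pairArrayVariation_of_edgeClauses_explicit (hG : G.WF) (hP : P.WF) (hQc : Qc.WF) {β U μ : ℝ} (hU : 0 ≤ U) {n : ℕ} {sG sQ tG tQ : ℝ}
    (hsG : 0 ≤ sG) (hsQ : 0 ≤ sQ) (htG : 0 ≤ tG) (htQ : 0 ≤ tQ)
    (hκ : 12 * (tQ + sQ) + tQ ≤ klLegKappa)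
    (X : ℕ → TorusSite 2 L → TorusSite 2 L → TorusSite 2 L → ℝ) (hX0 : ∀ j Qm k k', 0 ≤ X j Qm k k')
    (hXsup : ∀ j Qm k k', X j Qm k k' ≤ sG * (G.CF * (P.Klam * U) ^ 2) + sQ * (Qc.CR * P.Klam ^ 3 * U ^ 2))
    (hXsum : ∀ (t : ℕ) (Qm k k' : TorusSite 2 L),
      ∑ j ∈ Ioc t n, X j Qm k k' ≤ tG * (G.CF * (P.Klam * U) ^ 2) + tQ * (Qc.CR * P.Klam ^ 3 * U ^ 2))
    (hXtot : ∀ Qm k k' : TorusSite 2 L,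
      X 0 Qm k k' + ∑ i ∈ range n, X (i + 1) Qm k k' ≤ tG * (G.CF * (P.Klam * U) ^ 2) + tQ * (Qc.CR * P.Klam ^ 3 * U ^ 2))
    (δ : ℕ → TorusSite 2 L → ℝ)
    (hneg : ∀ Qm : TorusSite 2 L, ∀ t ≤ n, IsPairClassAt L Qm t → 16 * U * ∑ i ∈ range t, δ (i + 1) Qm ≤ 1)
    (h0 : ∀ Qm : TorusSite 2 L, ∀ k ∈ klBall L μ 0, ∀ k' ∈ klBall L μ 0,
      ‖klPairAmplitude L M β U μ (klFlowFrameU L M β U μ 0) 0 Qm k k' - (U : ℂ)‖ ≤ initDevBar G U + X 0 Qm k k')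
    (hsteps : ∀ j, 1 ≤ j → j ≤ n → ∀ Qm : TorusSite 2 L, IsPairClassAt L Qm j →
      ∃ w : TorusSite 2 L → ℝ, (∑ p, |w p| ≤ G.bhi) ∧ (∑ p, (|w p| - w p) ≤ δ j Qm) ∧
        ∃ N : Matrix (TorusSite 2 L) (TorusSite 2 L) ℂ,
          (1 + Matrix.diagonal (fun p => (w p : ℂ)) * klPairArrayF L M β U μ (j - 1) Qm) * N = 1 ∧
          ∀ k ∈ klBall L μ 0, ∀ k' ∈ klBall L μ 0,
            ‖klPairAmplitude L M β U μ (klFlowFrameU L M β U μ j) j Qm k k' - (klPairArrayF L M β U μ (j - 1) Qm * N) k k'‖ ≤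
              drivePBar G P U (j - 1) + eremBar G P Qc U β L (j - 1) + X j Qm k k')
    (hincr : ∀ j, 1 ≤ j → j ≤ n → ∀ Qm : TorusSite 2 L, ∀ k ∈ klBall L μ 0, ∀ k' ∈ klBall L μ 0,
      ‖klPairAmplitude L M β U μ (klFlowFrameU L M β U μ j) j Qm k k' - klPairAmplitude L M β U μ (klFlowFrameU L M β U μ (j - 1)) (j - 1) Qm k k'‖ ≤
        gainBar G P U j (klTorusNorm L Qm) (klTorusNorm L (k - k')) (klTorusNorm L (k + k' - Qm)) +
          eremBar G P Qc U β L (j - 1) + X j Qm k k')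
    (hUCR : 2 * Qc.CR * P.Klam ^ 3 * |U| ≤ 1) (hL : 17 * ∑ j ∈ range n, Qc.CL β j / L ≤ U ^ 2)
    (hsmall : 8 * 42 * (((∑ χ : D4Irrep, (G.abot χ + G.atop χ) + 1) +
        2 * (G.aplus * P.Klam ^ 2 * G.Z + G.cloc * P.Klam ^ 2 * (1 - (4 : ℝ) ^ (-G.θ))⁻¹ + 1) + 1 +
          (tG + sG) * (G.CF * P.Klam ^ 2) + (tQ + sQ) * (Qc.CR * P.Klam ^ 3)) * U ^ 2) * (G.bhi * n) ≤ 1)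
    (hCW : 12 * (∑ χ : D4Irrep, (G.abot χ + G.atop χ) + 1) +
        25 * (G.aplus * P.Klam ^ 2 * G.Z + G.cloc * P.Klam ^ 2 * (1 - (4 : ℝ) ^ (-G.θ))⁻¹ + 1) + 2 +
          (12 * (tG + sG) + 3 + tG) * (G.CF * P.Klam ^ 2) ≤ P.C_W) :
    ∀ Qm : TorusSite 2 L, ∃ u W m : ℕ → ℝ, u 0 = U ∧ (∀ i, u (i + 1) = u i / (1 + W i * u i)) ∧
      (∀ i, |W i| ≤ m i ∧ m i ≤ G.bhi) ∧
      (∀ i < n, IsPairClassAt L Qm (i + 1) → m i - W i ≤ δ (i + 1) Qm) ∧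
      (∀ i, (n ≤ i ∨ ¬ IsPairClassAt L Qm (i + 1)) → W i = 0 ∧ m i = 0) ∧
      16 * U * ∑ i ∈ range n, (m i - W i) ≤ 1 ∧
      (∀ i j, i ≤ j → j ≤ n → u j ≤ u i + (16 / 15 * U) ^ 2 * ∑ l ∈ Ico i j, (m l - W l)) ∧
      ∑ i ∈ range n, |u (i + 1) - u i| ≤ 257 / 225 * U ∧
      (∀ j ≤ n, 0 ≤ u j ∧ u j ≤ 2 * |U| ∧ ∀ k ∈ klBall L μ 0, ∀ k' ∈ klBall L μ 0,
        ‖klPairAmplitude L M β U μ (klFlowFrameU L M β U μ j) j Qm k k' - (u j : ℂ)‖ ≤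
          (P.C_W + klLegKappa * Qc.CR * P.Klam ^ 3) * U ^ 2) ∧
      (∀ i < n, IsPairClassAt L Qm (i + 1) → ∀ k ∈ klBall L μ 0, ∀ k' ∈ klBall L μ 0,
        ‖klPairAmplitude L M β U μ (klFlowFrameU L M β U μ (i + 1)) (i + 1) Qm k k' -
            klPairAmplitude L M β U μ (klFlowFrameU L M β U μ i) i Qm k k' - ((u (i + 1) - u i : ℝ) : ℂ)‖ ≤
          m i * ((P.C_W + klLegKappa * Qc.CR * P.Klam ^ 3) * U ^ 2 *
              (7 / 3 * U + 13 / 12 * ((P.C_W + klLegKappa * Qc.CR * P.Klam ^ 3) * U ^ 2))) +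
            (drivePBar G P U i + eremBar G P Qc U β L i) + X (i + 1) Qm k k') ∧
      ∀ k ∈ klBall L μ 0, ∀ k' ∈ klBall L μ 0,
        ∑ i ∈ range n, ‖klPairAmplitude L M β U μ (klFlowFrameU L M β U μ (i + 1)) (i + 1) Qm k k' -
            klPairAmplitude L M β U μ (klFlowFrameU L M β U μ i) i Qm k k'‖ ≤
          11 / 9 * U + (P.C_W + klLegKappa * Qc.CR * P.Klam ^ 3) * U ^ 2 := by
  have hdrive := drivePBar_sum_le (P := P) hG U n
  have herem := eremBar_sum_le hG hP hQc U β L n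
  have hU2 : 0 ≤ U ^ 2 := sq_nonneg U
  have hCL0 : 0 ≤ ∑ j ∈ range n, Qc.CL β j / L := sum_nonneg fun j _ => div_nonneg (hQc.2.2.2.2.2.2.2 β j) (Nat.cast_nonneg L)
  have hθ : 0 < G.θ := hG.2.2.2.2.2.1
  have hg : 0 ≤ (1 - (4 : ℝ) ^ (-G.θ))⁻¹ :=
    inv_nonneg.2 (by have := Real.rpow_lt_one_of_one_lt_of_neg (x := (4 : ℝ)) (by norm_num) (by linarith : -G.θ < 0); linarith)
  have hK0 : 0 ≤ P.Klam := zero_le_one.trans hP.1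
  have hcloc : 0 ≤ G.cloc := hG.2.2.2.2.1
  have haplus : 0 ≤ G.aplus := hG.2.2.2.2.2.2.2.2.2.2.1
  have hCF : 0 ≤ G.CF := hG.2.2.2.2.2.2.2.2.2.2.2.2.2.1
  have hCR : 0 ≤ Qc.CR := hQc.2.1
  have hbhi : 0 ≤ G.bhi := hG.2.2.1.trans hG.2.2.2.1
  have hab : 0 ≤ ∑ χ : D4Irrep, (G.abot χ + G.atop χ) := sum_nonneg fun χ _ => add_nonneg (hG.2.1 χ) (hG.1 χ)
  have hZ : 0 ≤ G.Z := le_trans (sum_nonneg fun j _ => hG.2.2.2.2.2.2.2.2.1 j) (hG.2.2.2.2.2.2.2.2.2.1 0)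
  -- the two quadratic units `g2 = CF·(Klam U)²`, `q3 = CR·Klam³·U²` and the product facts `linarith` needs
  have hg20 : 0 ≤ G.CF * (P.Klam * U) ^ 2 := by positivity
  have hq30 : 0 ≤ Qc.CR * P.Klam ^ 3 * U ^ 2 := by positivity
  have hsq : G.CF * (P.Klam * U) ^ 2 = (G.CF * P.Klam ^ 2) * U ^ 2 := by ring
  have hCRU : 2 * Qc.CR * P.Klam ^ 3 * |U| * U ^ 2 ≤ U ^ 2 := by nlinarith
  have hS : ∑ j ∈ range n, (drivePBar G P U j + eremBar G P Qc U β L j) ≤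
      (G.aplus * P.Klam ^ 2 * G.Z + G.cloc * P.Klam ^ 2 * (1 - (4 : ℝ) ^ (-G.θ))⁻¹) * U ^ 2 +
        2 * Qc.CR * P.Klam ^ 3 * |U| * U ^ 2 + ∑ j ∈ range n, Qc.CL β j / L := by
    rw [sum_add_distrib]; nlinarith [hdrive, herem]
  have hS0 : 0 ≤ ∑ j ∈ range n, (drivePBar G P U j + eremBar G P Qc U β L j) :=
    sum_nonneg fun j _ => add_nonneg (drivePBar_nonneg' hG U j) (eremBar_nonneg' hG hP hQc U β L j)
  have hinit : initDevBar G U = (∑ χ : D4Irrep, (G.abot χ + G.atop χ) + 1) * U ^ 2 := rfl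
  have hn0 : (0 : ℝ) ≤ n := Nat.cast_nonneg n
  have hSe0 : 0 ≤ ∑ i ∈ range n, eremBar G P Qc U β L i := sum_nonneg fun i _ => eremBar_nonneg' hG hP hQc U β L i
  have haKZU : 0 ≤ G.aplus * P.Klam ^ 2 * G.Z * U ^ 2 := by positivity
  have hcKgU : 0 ≤ G.cloc * P.Klam ^ 2 * (1 - (4 : ℝ) ^ (-G.θ))⁻¹ * U ^ 2 := by positivity
  have hXtot0 : 0 ≤ tG * (G.CF * (P.Klam * U) ^ 2) + tQ * (Qc.CR * P.Klam ^ 3 * U ^ 2) := by positivity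
  have hXsup0 : 0 ≤ sG * (G.CF * (P.Klam * U) ^ 2) + sQ * (Qc.CR * P.Klam ^ 3 * U ^ 2) := by positivity
  -- the no-onset line
  have hsm : 8 * 42 * ((initDevBar G U + ∑ j ∈ range n, (drivePBar G P U j + eremBar G P Qc U β L j) +
          (tG * (G.CF * (P.Klam * U) ^ 2) + tQ * (Qc.CR * P.Klam ^ 3 * U ^ 2))) +
        (∑ j ∈ range n, (drivePBar G P U j + eremBar G P Qc U β L j) +
          (sG * (G.CF * (P.Klam * U) ^ 2) + sQ * (Qc.CR * P.Klam ^ 3 * U ^ 2)))) * (G.bhi * n) ≤ 1 := by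
    refine le_trans ?_ hsmall
    have hmain : (initDevBar G U + ∑ j ∈ range n, (drivePBar G P U j + eremBar G P Qc U β L j) +
          (tG * (G.CF * (P.Klam * U) ^ 2) + tQ * (Qc.CR * P.Klam ^ 3 * U ^ 2))) +
        (∑ j ∈ range n, (drivePBar G P U j + eremBar G P Qc U β L j) +
          (sG * (G.CF * (P.Klam * U) ^ 2) + sQ * (Qc.CR * P.Klam ^ 3 * U ^ 2))) ≤
        ((∑ χ : D4Irrep, (G.abot χ + G.atop χ) + 1) +
          2 * (G.aplus * P.Klam ^ 2 * G.Z + G.cloc * P.Klam ^ 2 * (1 - (4 : ℝ) ^ (-G.θ))⁻¹ + 1) + 1 +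
            (tG + sG) * (G.CF * P.Klam ^ 2) + (tQ + sQ) * (Qc.CR * P.Klam ^ 3)) * U ^ 2 := by
      rw [hinit]
      linarith [hS, hCRU, hL, hCL0, hsq, hU2]
    have h0' : 0 ≤ (initDevBar G U + ∑ j ∈ range n, (drivePBar G P U j + eremBar G P Qc U β L j) +
          (tG * (G.CF * (P.Klam * U) ^ 2) + tQ * (Qc.CR * P.Klam ^ 3 * U ^ 2))) +
        (∑ j ∈ range n, (drivePBar G P U j + eremBar G P Qc U β L j) +
          (sG * (G.CF * (P.Klam * U) ^ 2) + sQ * (Qc.CR * P.Klam ^ 3 * U ^ 2))) := by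
      rw [hinit]; positivity
    exact mul_le_mul_of_nonneg_right (mul_le_mul_of_nonneg_left hmain (by norm_num)) (mul_nonneg hbhi hn0)
  -- the tolerance line: `24·S + Σē ≤ (25(aKZ + cKg) + 27)·U²`, the `g2`/`q3` numerals, `C_W`, `klLegKappa`
  have herem' : ∑ i ∈ range n, eremBar G P Qc U β L i ≤
      G.cloc * P.Klam ^ 2 * (1 - (4 : ℝ) ^ (-G.θ))⁻¹ * U ^ 2 + 2 * Qc.CR * P.Klam ^ 3 * |U| * U ^ 2 +
        ∑ j ∈ range n, Qc.CL β j / L := by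
    have := herem; linarith
  have hT1 : 24 * ∑ j ∈ range n, (drivePBar G P U j + eremBar G P Qc U β L j) + ∑ i ∈ range n, eremBar G P Qc U β L i ≤
      25 * (G.aplus * P.Klam ^ 2 * G.Z * U ^ 2 + G.cloc * P.Klam ^ 2 * (1 - (4 : ℝ) ^ (-G.θ))⁻¹ * U ^ 2) + 27 * U ^ 2 := by
    linarith [hS, herem', hCRU, hL, hCL0, haKZU]
  have hCWU := mul_le_mul_of_nonneg_right hCW hU2
  have hκq : (12 * (tQ + sQ) + tQ) * (Qc.CR * P.Klam ^ 3 * U ^ 2) ≤ klLegKappa * (Qc.CR * P.Klam ^ 3 * U ^ 2) :=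
    mul_le_mul_of_nonneg_right hκ hq30
  intro Qm
  obtain ⟨u, W, m, hu0, hlaw, hWm, hdef, hzero, hnegm, hu, hinc, htvA⟩ := flowPairArray_variation_edge L M hG hP hQc hU X
    (Xtot := tG * (G.CF * (P.Klam * U) ^ 2) + tQ * (Qc.CR * P.Klam ^ 3 * U ^ 2))
    (Xsup := sG * (G.CF * (P.Klam * U) ^ 2) + sQ * (Qc.CR * P.Klam ^ 3 * U ^ 2)) hX0 hXtot0 hXsup0
    hXsup hXsum hXtot δ hneg h0 hsteps hincr Qm hsm
  -- the scalar consequences: quasi-monotonicity and total variation, with `ν i := m i − W i`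
  have hu0' : 0 ≤ u 0 := by rw [hu0]; exact hU
  have hWν : ∀ i, -(m i - W i) ≤ W i := fun i => by linarith [(hWm i).1, abs_nonneg (W i)]
  have hν0 : ∀ i, 0 ≤ m i - W i := fun i => by linarith [(hWm i).1, le_abs_self (W i)]
  have hm0 : ∀ i, 0 ≤ m i := fun i => (abs_nonneg _).trans (hWm i).1
  have hnegm' : 16 * u 0 * ∑ i ∈ range n, (m i - W i) ≤ 1 := by rw [hu0]; exact hnegm
  have hqm := sWaveFloor_le_add_sum (U := u) (W := W) (ν := fun i => m i - W i) (N := n) hu0' hlaw hWν hν0 hnegm'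
  have htv := sWaveFloor_totalVariation_le' (U := u) (W := W) (ν := fun i => m i - W i) (N := n) hu0' hlaw hWν hν0 hnegm'
  rw [hu0] at hqm htv
  -- the budget lines: `12·(A + R) ≤ C_W′·U²` (the (B1-F) tolerance) and `R ≤ A + R`
  set A2 : ℝ := (initDevBar G U + ∑ j ∈ range n, (drivePBar G P U j + eremBar G P Qc U β L j) +
      (tG * (G.CF * (P.Klam * U) ^ 2) + tQ * (Qc.CR * P.Klam ^ 3 * U ^ 2))) +
    (∑ j ∈ range n, (drivePBar G P U j + eremBar G P Qc U β L j) +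
      (sG * (G.CF * (P.Klam * U) ^ 2) + sQ * (Qc.CR * P.Klam ^ 3 * U ^ 2))) with hA2
  set R2 : ℝ := ∑ j ∈ range n, (drivePBar G P U j + eremBar G P Qc U β L j) +
      (sG * (G.CF * (P.Klam * U) ^ 2) + sQ * (Qc.CR * P.Klam ^ 3 * U ^ 2)) with hR2
  set Fz : ℝ := (P.Klam * U) ^ 2 * (3 * G.CF) + (tG * (G.CF * (P.Klam * U) ^ 2) + tQ * (Qc.CR * P.Klam ^ 3 * U ^ 2)) +
      ∑ i ∈ range n, eremBar G P Qc U β L i with hFz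
  set CW2 : ℝ := (P.C_W + klLegKappa * Qc.CR * P.Klam ^ 3) with hCW2
  have hFz0 : 0 ≤ Fz := by rw [hFz]; positivity
  have hR2le : R2 ≤ A2 := by
    have hx : 0 ≤ (∑ χ : D4Irrep, (G.abot χ + G.atop χ) + 1) * U ^ 2 := mul_nonneg (by linarith [hab]) hU2
    rw [hR2, hA2, hinit]; linarith [hS0, hXtot0]
  have hR20 : 0 ≤ R2 := by rw [hR2]; positivity
  have htol : 12 * A2 + Fz ≤ CW2 * U ^ 2 := by
    rw [hA2, hFz, hCW2, hinit]
    linarith [hT1, hCWU, hκq, hq30, hg20, hS0, hSe0, hsq]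
  have hA2tol : 12 * A2 ≤ CW2 * U ^ 2 := by linarith
  have htolU0 : 0 ≤ CW2 * U ^ 2 := by linarith [hR20]
  -- the remainder coefficient of the increment law in `C_W′`-currency
  have hcoef : (2 * (16 / 15 * U) + 12 * A2 + R2) * (12 * A2) + R2 * (16 / 15 * U) ≤
      CW2 * U ^ 2 * (7 / 3 * U + 13 / 12 * (CW2 * U ^ 2)) := by
    have h1 : R2 ≤ CW2 * U ^ 2 / 12 := by linarith
    have h2 : (2 * (16 / 15 * U) + 12 * A2 + R2) * (12 * A2) ≤ (2 * (16 / 15 * U) + CW2 * U ^ 2 + CW2 * U ^ 2 / 12) * (CW2 * U ^ 2) :=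
      mul_le_mul (by linarith) hA2tol (by linarith) (by linarith [htolU0, hU])
    have h3 : R2 * (16 / 15 * U) ≤ CW2 * U ^ 2 / 12 * (16 / 15 * U) := mul_le_mul_of_nonneg_right h1 (by positivity)
    have h4 : 0 ≤ CW2 * U ^ 2 * U := mul_nonneg htolU0 hU
    have h5 : (2 * (16 / 15 * U) + CW2 * U ^ 2 + CW2 * U ^ 2 / 12) * (CW2 * U ^ 2) + CW2 * U ^ 2 / 12 * (16 / 15 * U) =
        CW2 * U ^ 2 * (7 / 3 * U + 13 / 12 * (CW2 * U ^ 2)) - CW2 * U ^ 2 * U / 9 := by ring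
    linarith [h2, h3, h4, h5]
  refine ⟨u, W, m, hu0, hlaw, hWm, hdef, hzero, hnegm, hqm, htv, fun j hjn => ?_, fun i hi hQi k hk k' hk' => ?_, fun k hk k' hk' => ?_⟩
  · obtain ⟨huj0, hujU, hd⟩ := hu j hjn
    refine ⟨huj0, hujU.trans (by rw [abs_of_nonneg hU]; linarith), fun k hk k' hk' => (hd k hk k' hk').trans ?_⟩
    linarith [htol]
  · refine (hinc i hi hQi k hk k' hk').trans ?_
    have := mul_le_mul_of_nonneg_left hcoef (hm0 i)
    linarith
  · refine (htvA k hk k' hk').trans ?_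
    linarith [htol, hR2le, hR20, hFz0]

end Model

end Summit.HubbardSuperconductivity.HubbardSuperconductivity.Theorems.KLRegimeSplit

end
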